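import Literature.NumberTheory.LFunctions.RealZeroRepulsionOddClassSum
import Literature.NumberTheory.LFunctions.NoRealZeroTruncationBaseV
import Literature.NumberTheory.LFunctions.NoRealZeroTruncationBaseVI
import HarnessLib

/-!
# `1 − β > 1.5/√d` for EVERY odd real primitive character (all conductors `d > 4`), kernel: the class-sum bound
# above `d = 441` and the kernel floor `NoRealZeroUpTo 4000` below

Topic `Literature/NumberTheory/LFunctions` (namespace `Literature.NumberTheory.LFunctions`, sub-namespace
`ClassSumRepulsion`). Everything here is PROVED (theorems only; no definition, no named fact, debt 0; the imported
floor `noRealZeroUpTo_4000` is itself a kernel theorem, `decide`-certified, hypothesis-free). Cell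
`parity-realchar`, TARGET §2 row 16 ODD column: the uniform statement for the row.

* `one_sub_realZero_gt_three_halves_of_odd_all` — **for every odd primitive quadratic `χ` mod `d > 4` and every
  real `β < 1` with `L(β, χ) = 0`: `1 − β > 1.5/√d`** (`d ≥ 441`: `RealZeroRepulsionOddClassSum.lean`; `d ≤ 4000`:
  the floor has no real zero in `(0, 1)` at all, so `β ≤ 0` and `1 − β ≥ 1 > 1.5/√d`);
* `LFunction_ne_zero_near_one_of_odd_all` — no zero of `L(s, χ)` at real `σ ∈ [1 − 1.5/√d, 1)`, all odd `d > 4`;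
* `not_isSiegelZero_of_le` / `isSiegelZero_quality_lt_of_odd_all` — below the floor no Tao–Teräväinen Siegel
  zero at all; above, quality `η < √d/(1.5 log d)`;
* `not_isSiegelZero_of_odd_of_le_15000` — hence **no Tao–Teräväinen Siegel zero (`η ≥ 10`) at any odd primitive
  quadratic character of conductor `d ≤ 15 000`**, table-free (`√d < 122.5 < 15 log d` on `(4000, 15000]`);
* `not_isSiegelZero_of_odd_of_forty_le` — and **none of quality `η ≥ 40` for `d ≤ 600 000`** (`√d < 60 log d` on
  `(4000, 600000]`, three pieces).

LABEL (cell rule): row 16 ODD column, kernel, hypothesis-free, all conductors. WHAT THIS IS NOT: even characters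
untouched; nothing here bears on parity (H5).
-/

noncomputable section

open Complex
open Literature.Barriers.Parity

namespace Literature.NumberTheory.LFunctions

namespace ClassSumRepulsion

/-- **`1 − β > 1.5/√d` for every real zero `β < 1` of `L(s, χ)`, every ODD primitive quadratic `χ`, ALL
conductors `d > 4`** (kernel floor `noRealZeroUpTo_4000` for `d ≤ 4000`, the class-sum bound for `d ≥ 441`).
[cite: GoldfeldSchinzel1975, Corollary p. 572 (case d < 0)] -/
theorem one_sub_realZero_gt_three_halves_of_odd_all {d : ℕ} [NeZero d] (hd : 4 < d)
    {χ : DirichletCharacter ℂ d} (hprim : χ.IsPrimitive) (hquad : χ.IsQuadratic) (hodd : χ.Odd)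
    {β : ℝ} (hβ1 : β < 1) (hz : χ.LFunction β = 0) : 1.5 / Real.sqrt d < 1 - β := by
  rcases le_or_gt 441 d with h441 | h441
  · exact one_sub_realZero_gt_three_halves_of_odd h441 hprim hquad hodd hβ1 hz
  · -- `d ≤ 4000`: no real zero in `(0, 1)` at all, hence `β ≤ 0`
    have hβ0 : β ≤ 0 := by
      by_contra hcon
      push Not at hcon
      exact noRealZeroUpTo_4000 d (by omega) (by omega) χ hquad hprim β hcon hβ1 hz
    have hdR : (4 : ℝ) < d := by exact_mod_cast hd
    have hsd : 2 ≤ Real.sqrt d := (Real.le_sqrt' two_pos).2 (by linarith)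
    have h1 : 1.5 / Real.sqrt d < 1 := by
      rw [div_lt_one (by linarith)]; linarith
    linarith

/-- **No zero of `L(s, χ)` at real `σ ∈ [1 − 1.5/√d, 1)`**, every odd primitive quadratic `χ` mod `d > 4`.
[cite: GoldfeldSchinzel1975, Corollary p. 572 (case d < 0)] -/
theorem LFunction_ne_zero_near_one_of_odd_all {d : ℕ} [NeZero d] (hd : 4 < d)
    {χ : DirichletCharacter ℂ d} (hprim : χ.IsPrimitive) (hquad : χ.IsQuadratic) (hodd : χ.Odd)
    {σ : ℝ} (hσ : 1 - 1.5 / Real.sqrt d ≤ σ) (hσ1 : σ < 1) : χ.LFunction σ ≠ 0 := by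
  intro h0
  have h := one_sub_realZero_gt_three_halves_of_odd_all hd hprim hquad hodd hσ1 h0
  linarith

/-- **No Tao–Teräväinen Siegel zero at an odd (indeed any) primitive quadratic character of conductor
`3 ≤ d ≤ 4000`** (kernel floor: no real zero in `(0, 1)`; the would-be zero `1 − 1/(η log d)` lies in `(0, 1)` for
`η ≥ 10`, `d ≥ 3`). [cite: TaoTeravainen2021, Definition 1.4] -/
theorem not_isSiegelZero_of_le {d : ℕ} [NeZero d] (hd3 : 3 ≤ d) (hd : d ≤ 4000)
    {χ : DirichletCharacter ℂ d} {η : ℝ} : ¬ IsSiegelZero χ η := by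
  rintro ⟨hprim, hquad, h10, hzero⟩
  have hdR : (3 : ℝ) ≤ d := by exact_mod_cast hd3
  have hlog : 1 < Real.log d := by
    rw [Real.lt_log_iff_exp_lt (by linarith)]
    have := Real.exp_one_lt_d9; linarith
  have hη : 0 < η := by linarith
  have hpos : 0 < 1 / (η * Real.log d) := by positivity
  have hlt1 : 1 / (η * Real.log d) < 1 := by
    rw [div_lt_one (by positivity)]; nlinarith
  exact noRealZeroUpTo_4000 d hd3 hd χ hquad hprim (1 - 1 / (η * Real.log d)) (by linarith) (by linarith)
    (by exact_mod_cast hzero)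

/-- **Quality of a Siegel zero at an odd character, all conductors: `η < √d/(1.5 log d)`** (`d > 4`; for
`d ≤ 4000` there is none). [cite: TaoTeravainen2021, Definition 1.4]
[cite: GoldfeldSchinzel1975, Corollary p. 572 (case d < 0)] -/
theorem isSiegelZero_quality_lt_of_odd_all {d : ℕ} [NeZero d] (hd : 4 < d)
    {χ : DirichletCharacter ℂ d} {η : ℝ} (hS : IsSiegelZero χ η) (hodd : χ.Odd) :
    η < Real.sqrt d / (1.5 * Real.log d) := by
  rcases le_or_gt 441 d with h441 | h441
  · exact isSiegelZero_quality_lt_of_odd h441 hS hodd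
  · exact absurd hS (not_isSiegelZero_of_le (by omega) (by omega))

/-! ### No Tao–Teräväinen Siegel zero at odd conductors `d ≤ 15 000` (table-free) -/

/-- `e^{8.25} < 4000`, hence `log d ≥ 8.25` for `d ≥ 4000`. [folklore] -/
private theorem log_ge_of_ge_4000 {d : ℕ} (hd : 4000 ≤ d) : 8.25 ≤ Real.log d := by
  have hdR : (4000 : ℝ) ≤ d := by exact_mod_cast hd
  rw [Real.le_log_iff_exp_le (by linarith)]
  have he := Real.exp_one_lt_d9
  have he0 := Real.exp_pos (1 : ℝ)
  -- `e^{1/4} < 1.2841` since `1.2841^4 > e`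
  have hq : Real.exp (1 / 4) < 1.2841 := by
    by_contra hcon
    push Not at hcon
    have h4 : Real.exp (1 / 4) ^ 4 = Real.exp 1 := by
      rw [← Real.exp_nat_mul]; norm_num
    have : (1.2841 : ℝ) ^ 4 ≤ Real.exp (1 / 4) ^ 4 := by
      exact pow_le_pow_left₀ (by norm_num) hcon 4
    rw [h4] at this
    norm_num at this
    linarith
  have h8 : Real.exp 8 = Real.exp 1 ^ 8 := by rw [← Real.exp_nat_mul]; norm_num
  have h8' : Real.exp 8 < 2981 := by
    rw [h8]
    have : Real.exp 1 ^ 8 < 2.7182818286 ^ 8 := by gcongr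
    linarith [show (2.7182818286 : ℝ) ^ 8 < 2981 by norm_num]
  have hsplit : Real.exp 8.25 = Real.exp 8 * Real.exp (1 / 4) := by
    rw [← Real.exp_add]; norm_num
  rw [hsplit]
  nlinarith [Real.exp_pos (8 : ℝ), Real.exp_pos (1 / 4 : ℝ)]

/-- **No Tao–Teräväinen Siegel zero (quality `η ≥ 10`) at any ODD primitive quadratic character of conductor
`3 ≤ d ≤ 15 000`** — kernel, hypothesis-free: below `4000` the floor `noRealZeroUpTo_4000`; on `(4000, 15000]`
the would-be zero `1 − 1/(η log d) ≥ 1 − 1/(10 log d)` lies in the zero-free window `[1 − 1.5/√d, 1)` because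
`√d ≤ √15000 < 122.5 < 123.75 ≤ 15 log d`. (The certified leaves of the column exclude every real zero up to
`4·10¹⁰`; this is the table-free kernel statement for the column's predicate.) [cite: TaoTeravainen2021, Definition 1.4]
[cite: GoldfeldSchinzel1975, Corollary p. 572 (case d < 0)] -/
theorem not_isSiegelZero_of_odd_of_le_15000 {d : ℕ} [NeZero d] (hd3 : 3 ≤ d) (hd : d ≤ 15000)
    {χ : DirichletCharacter ℂ d} {η : ℝ} (hodd : χ.Odd) : ¬ IsSiegelZero χ η := by
  intro hS
  obtain ⟨hprim, hquad, h10, hzero⟩ := id hS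
  rcases le_or_gt d 4000 with h4000 | h4000
  · -- the floor: no real zero in `(0, 1)`
    have hdR : (3 : ℝ) ≤ d := by exact_mod_cast hd3
    have hlog : 1 < Real.log d := by
      rw [Real.lt_log_iff_exp_lt (by linarith)]
      have := Real.exp_one_lt_d9; linarith
    have hη : 0 < η := by linarith
    have hpos : 0 < 1 / (η * Real.log d) := by positivity
    have hlt1 : 1 / (η * Real.log d) < 1 := by
      rw [div_lt_one (by positivity)]; nlinarith
    exact noRealZeroUpTo_4000 d hd3 h4000 χ hquad hprim (1 - 1 / (η * Real.log d)) (by linarith) (by linarith)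
      (by exact_mod_cast hzero)
  · -- `4000 < d ≤ 15000`: quality bound `η < √d/(1.5 log d)` contradicts `η ≥ 10`
    have hq := isSiegelZero_quality_lt_of_odd (by omega) hS hodd
    have hlog := log_ge_of_ge_4000 (by omega : 4000 ≤ d)
    have hdR : (d : ℝ) ≤ 15000 := by exact_mod_cast hd
    have hsd : Real.sqrt d < 122.5 := by
      rw [Real.sqrt_lt' (by norm_num)]; nlinarith
    have hlog0 : 0 < Real.log d := by linarith
    rw [lt_div_iff₀ (by positivity)] at hq
    nlinarith

/-! ### No Siegel zero of quality `η ≥ 40` at odd conductors `d ≤ 600 000` (table-free) -/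

/-- `e < 2.7182818286` to a power: `e^n < b` from `2.7182818286^n < b`. [folklore] -/
private theorem exp_nat_lt {n : ℕ} {b : ℝ} (hb : (2.7182818286 : ℝ) ^ n < b) : Real.exp n < b := by
  have h : Real.exp n = Real.exp 1 ^ n := by rw [← Real.exp_nat_mul]; norm_num
  rw [h]
  have : Real.exp 1 ^ n ≤ 2.7182818286 ^ n := by
    exact pow_le_pow_left₀ (Real.exp_pos 1).le Real.exp_one_lt_d9.le n
  linarith

/-- `e^{3/10} < 1.43` (`1.43^{10} > e^3`). [folklore] -/
private theorem exp_three_tenths_lt : Real.exp (3 / 10) < 1.43 := by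
  by_contra hcon
  push Not at hcon
  have h10 : Real.exp (3 / 10) ^ 10 = Real.exp 3 := by rw [← Real.exp_nat_mul]; norm_num
  have h3 : Real.exp 3 < 20.1 := exp_nat_lt (n := 3) (by norm_num)
  have : (1.43 : ℝ) ^ 10 ≤ Real.exp (3 / 10) ^ 10 := pow_le_pow_left₀ (by norm_num) hcon 10
  rw [h10] at this
  norm_num at this
  linarith

/-- `e^{1/10} < 1.106` (`1.106^{10} > e`). [folklore] -/
private theorem exp_tenth_lt : Real.exp (1 / 10) < 1.106 := by
  by_contra hcon
  push Not at hcon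
  have h10 : Real.exp (1 / 10) ^ 10 = Real.exp 1 := by rw [← Real.exp_nat_mul]; norm_num
  have : (1.106 : ℝ) ^ 10 ≤ Real.exp (1 / 10) ^ 10 := pow_le_pow_left₀ (by norm_num) hcon 10
  rw [h10] at this
  norm_num at this
  linarith [Real.exp_one_lt_d9]

/-- `log d ≥ 12.3` for `d ≥ 240 000` (`e^{12.3} = e^{12}e^{0.3} < 162755·1.43 < 240000`). [folklore] -/
private theorem log_ge_of_ge_240000 {d : ℕ} (hd : 240000 ≤ d) : 12.3 ≤ Real.log d := by
  have hdR : (240000 : ℝ) ≤ d := by exact_mod_cast hd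
  rw [Real.le_log_iff_exp_le (by linarith)]
  have h12 : Real.exp 12 < 162755 := exp_nat_lt (n := 12) (by norm_num)
  have hsplit : Real.exp 12.3 = Real.exp 12 * Real.exp (3 / 10) := by rw [← Real.exp_add]; norm_num
  rw [hsplit]
  nlinarith [Real.exp_pos (12 : ℝ), Real.exp_pos (3 / 10 : ℝ), exp_three_tenths_lt]

/-- `log d ≥ 13.1` for `d ≥ 500 000` (`e^{13.1} = e^{13}e^{0.1} < 442414·1.106 < 500000`). [folklore] -/
private theorem log_ge_of_ge_500000 {d : ℕ} (hd : 500000 ≤ d) : 13.1 ≤ Real.log d := by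
  have hdR : (500000 : ℝ) ≤ d := by exact_mod_cast hd
  rw [Real.le_log_iff_exp_le (by linarith)]
  have h13 : Real.exp 13 < 442414 := exp_nat_lt (n := 13) (by norm_num)
  have hsplit : Real.exp 13.1 = Real.exp 13 * Real.exp (1 / 10) := by rw [← Real.exp_add]; norm_num
  rw [hsplit]
  nlinarith [Real.exp_pos (13 : ℝ), Real.exp_pos (1 / 10 : ℝ), exp_tenth_lt]

/-- **No Siegel zero of quality `η ≥ 40` at any ODD primitive quadratic character of conductor
`3 ≤ d ≤ 600 000`** — kernel, table-free: the would-be zero `1 − 1/(η log d) ≥ 1 − 1/(40 log d)` lies in the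
zero-free window `[1 − 1.5/√d, 1)` because `√d < 60 log d` on `(4000, 600000]` (three pieces:
`√240000 < 490 < 495 ≤ 60·8.25`, `√500000 < 708 < 738 = 60·12.3`, `√600000 < 775 < 786 = 60·13.1`); below `4000`
the floor. [cite: TaoTeravainen2021, Definition 1.4] [cite: GoldfeldSchinzel1975, Corollary p. 572 (case d < 0)] -/
theorem not_isSiegelZero_of_odd_of_forty_le {d : ℕ} [NeZero d] (hd3 : 3 ≤ d) (hd : d ≤ 600000)
    {χ : DirichletCharacter ℂ d} {η : ℝ} (hodd : χ.Odd) (h40 : 40 ≤ η) : ¬ IsSiegelZero χ η := by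
  intro hS
  obtain ⟨hprim, hquad, -, hzero⟩ := id hS
  rcases le_or_gt d 4000 with h4000 | h4000
  · have hdR : (3 : ℝ) ≤ d := by exact_mod_cast hd3
    have hlog : 1 < Real.log d := by
      rw [Real.lt_log_iff_exp_lt (by linarith)]
      have := Real.exp_one_lt_d9; linarith
    have hη : 0 < η := by linarith
    have hpos : 0 < 1 / (η * Real.log d) := by positivity
    have hlt1 : 1 / (η * Real.log d) < 1 := by
      rw [div_lt_one (by positivity)]; nlinarith
    exact noRealZeroUpTo_4000 d hd3 h4000 χ hquad hprim (1 - 1 / (η * Real.log d)) (by linarith) (by linarith)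
      (by exact_mod_cast hzero)
  · -- the zero `β₀ = 1 − 1/(η log d)` has `1 − β₀ ≤ 1/(40 log d) < 1.5/√d` on `(4000, 600000]`
    have hdR : (d : ℝ) ≤ 600000 := by exact_mod_cast hd
    have hd441 : 441 ≤ d := by omega
    have hη : 0 < η := by linarith
    have hd0 : (0 : ℝ) < d := by exact_mod_cast (show 0 < d by omega)
    have hlog0 : 0 < Real.log d := Real.log_pos (by exact_mod_cast (show 1 < d by omega))
    have hβ1 : 1 - 1 / (η * Real.log d) < 1 := by
      have : 0 < 1 / (η * Real.log d) := by positivity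
      linarith
    have h := one_sub_realZero_gt_three_halves_of_odd hd441 hprim hquad hodd hβ1 (by exact_mod_cast hzero)
    rw [show (1 : ℝ) - (1 - 1 / (η * Real.log d)) = 1 / (η * Real.log d) by ring] at h
    -- `1/(η log d) ≤ 1/(40 log d)`
    have h40' : 1 / (η * Real.log d) ≤ 1 / (40 * Real.log d) :=
      one_div_le_one_div_of_le (by positivity) (mul_le_mul_of_nonneg_right h40 hlog0.le)
    -- `√d < 60 log d`
    have hsl : Real.sqrt d < 60 * Real.log d := by
      rcases le_or_gt d 240000 with h24 | h24
      · have hl := log_ge_of_ge_4000 (by omega : 4000 ≤ d)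
        have : Real.sqrt d < 490 := by
          rw [Real.sqrt_lt' (by norm_num)]
          have : (d : ℝ) ≤ 240000 := by exact_mod_cast h24
          linarith
        linarith
      rcases le_or_gt d 500000 with h50 | h50
      · have hl := log_ge_of_ge_240000 (by omega : 240000 ≤ d)
        have : Real.sqrt d < 708 := by
          rw [Real.sqrt_lt' (by norm_num)]
          have : (d : ℝ) ≤ 500000 := by exact_mod_cast h50
          linarith
        linarith
      · have hl := log_ge_of_ge_500000 (by omega : 500000 ≤ d)
        have : Real.sqrt d < 775 := by
          rw [Real.sqrt_lt' (by norm_num)]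
          linarith
        linarith
    -- contradiction: `1.5/√d < 1/(η log d) ≤ 1/(40 log d) < 1.5/√d`
    have hsd0 : 0 < Real.sqrt d := Real.sqrt_pos.2 hd0
    have hlast : 1 / (40 * Real.log d) < 1.5 / Real.sqrt d := by
      rw [div_lt_div_iff₀ (by positivity) hsd0]; linarith
    linarith


/-! ### Re-base on the kernel floor `NoRealZeroUpTo 5000` (appended) -/

/-- **No Tao–Teräväinen Siegel zero at any primitive quadratic character of conductor `3 ≤ d ≤ 5000`** — the
re-base of `not_isSiegelZero_of_le` on the kernel floor `noRealZeroUpTo_5000` (prover g9, referee V249: no real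
zero in `(0, 1)` for every primitive quadratic `χ`, either parity, `q ≤ 5000`, `decide`-certified, hypothesis-free).
[cite: TaoTeravainen2021, Definition 1.4] -/
theorem not_isSiegelZero_of_le_5000 {d : ℕ} [NeZero d] (hd3 : 3 ≤ d) (hd : d ≤ 5000)
    {χ : DirichletCharacter ℂ d} {η : ℝ} : ¬ IsSiegelZero χ η := by
  rintro ⟨hprim, hquad, h10, hzero⟩
  have hdR : (3 : ℝ) ≤ d := by exact_mod_cast hd3
  have hlog : 1 < Real.log d := by
    rw [Real.lt_log_iff_exp_lt (by linarith)]
    have := Real.exp_one_lt_d9; linarith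
  have hη : 0 < η := by linarith
  have hpos : 0 < 1 / (η * Real.log d) := by positivity
  have hlt1 : 1 / (η * Real.log d) < 1 := by
    rw [div_lt_one (by positivity)]; nlinarith
  exact noRealZeroUpTo_5000 d hd3 hd χ hquad hprim (1 - 1 / (η * Real.log d)) (by linarith) (by linarith)
    (by exact_mod_cast hzero)

/-- **Every real zero `β ∈ (0, 1)` of `L(s, χ)` for a primitive quadratic `χ` (either parity) has conductor
`d > 5000`** — the floor as a one-liner for consumers. [cite: TaoTeravainen2021, Definition 1.4] -/
theorem conductor_gt_5000_of_realZero {d : ℕ} [NeZero d] (hd3 : 3 ≤ d)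
    {χ : DirichletCharacter ℂ d} (hprim : χ.IsPrimitive) (hquad : χ.IsQuadratic)
    {β : ℝ} (hβ0 : 0 < β) (hβ1 : β < 1) (hz : χ.LFunction β = 0) : 5000 < d := by
  by_contra hle
  push Not at hle
  exact noRealZeroUpTo_5000 d hd3 hle χ hquad hprim β hβ0 hβ1 hz

end ClassSumRepulsion

end Literature.NumberTheory.LFunctions

end
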